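import Summits.BirchSwinnertonDyer.BirchSwinnertonDyer.Theorems.ClassRecordThreeEulerHalvesAtThreeCarrierLocalE0Global
import Summits.BirchSwinnertonDyer.BirchSwinnertonDyer.Theorems.ClassRecordThreeCornerAtThreeShimuraWalkSplitCarrier
import Literature.NumberTheory.EllipticCurves.RingClassFieldDecompositionLaw
import HarnessLib

/-!
# `stub_carrierLocalE0AtThree` of `Cruxes/EulerHalvesAtThree/Lines/inert.lean` r17 — PROVED
# (cell `bsd-stepL`, seat `bsd-stepL-tam3-p1` g18, LINE OWNER of crux 19109 `EulerHalvesAtThree`; `--supports stmt-BirchSwinnertonDyer-19109`)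

The registered stub (r17, sha16 5cdb97ef4a332bd6) — VERBATIM: for `W/ℚ` globally minimal, `K` imaginary quadratic with its ring class tower
`K[·] ⊂ ℂ`, a prime `q` with `3 ∣ c_q(W/ℚ_q)` that SPLITS in `K`, every level `n ≠ 0` with `q ∤ n` and every place `w ∋ q` of `K[n]`:
(T) every `τ ∈ Aut_ℚ(K[n])` with `τ • w = w` has `τ P − P ∈ E₀(K[n])_w`, and (C) `c_q • P ∈ E₀(K[n])_w`.
PROOF. `w` is unramified over `ℚ`: `e(w | v) = 1` for `v = w ∩ 𝓞_K` since `v ∤ n` (`q ∈ v`, `q ∤ n`) — the tree's ring-class ramification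
law `ramificationIdx_ringClassField_eq_one` (Cox §9.A, er5-w4 g7 p638696) — and `e(v | q) = 1` since `q` splits in the quadratic `K`
(`LocalField.ramificationIdx_eq_one_and_inertiaDeg_eq_one_of_ne`); multiplicativity in the tower (Mathlib `ramificationIdx'_algebra_tower'`)
gives `e(w | q) = 1`, i.e. `¬ (q)𝓞_{K[n]} ≤ w²`. Then (T), (C) are tam3-p1 g18's `CarrierLocalE0.hasNonsingularReduction_pointGalHom_sub` ∕
`hasNonsingularReduction_localTamagawaNumber_nsmul` (`…CarrierLocalE0Global`, p644399, over `…CarrierLocalE0Completion`, p643818: Kodaira–Néron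
at a carrier over an unramified completion — `c_w = c_q`, `E(L_w) = ι E(ℚ_q) + E₀(L_w)`).
HONEST FRAMING: ONE theorem = the registered stub, by name and signature; no definition, no named fact, no `sorry`. It closes NO item by itself
(six other stubs of the line stay open); 19109 OPEN; BSD is proved for no curve (T7). References (locators only):
[cite: SilvermanATAEC1994, IV Cor. 9.2 (d), IV.9.4 Table 4.1] [cite: SilvermanAEC2009, VII Prop. 2.1, Prop. VII.5.4 (a), Thm. VII.6.1]
[cite: Cox2013, §9.A (ring class fields unramified outside the conductor)] [cite: CasselsFrohlichANT1967, Ch. VII §1.1, Prop. 1.2 (ii)].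
presearch: n/a (assembly). Axioms: `propext`, `Classical.choice`, `Quot.sound`.
-/

set_option autoImplicit false
set_option linter.dupNamespace false

noncomputable section

open scoped Classical NumberField Pointwise

namespace Summit.BirchSwinnertonDyer.BirchSwinnertonDyer.Theorems.CarrierLocalE0

open WeierstrassCurve IsDedekindDomain NumberField Field Literature.NumberTheory.EllipticCurves
  Literature.NumberTheory.EllipticCurves.RingClassField Literature.NumberTheory.Automorphic
  Literature.NumberTheory.GaloisRepresentations

/-- **`K[n]` is unramified over `ℚ` at a place `w ∋ q` with `q ∤ n`, `q` split in `K`**: `¬ (q)𝓞_{K[n]} ≤ w²`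
(`e(w | w ∩ 𝓞_K) = 1` by the ring class ramification law, `e(w ∩ 𝓞_K | q) = 1` as `q` splits, and the tower formula).
[cite: Cox2013, §9.A] [cite: CasselsFrohlichANT1967, Ch. VII Prop. 1.2 (ii)] -/
theorem not_map_le_sq_ringClassField (K : Type) [Field K] [NumberField K] (ι : K →+* ℂ)
    [∀ j : ℕ, NumberField (ringClassField K ι j)] (hK : IsImaginaryQuadratic K) (q : ℕ) [Fact q.Prime]
    (hq2 : ((Ideal.span {(q : ℤ)}).primesOver (𝓞 K)).ncard = 2) (n : ℕ) (hn : n ≠ 0) (hqn : ¬ q ∣ n)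
    (w : HeightOneSpectrum (𝓞 (ringClassField K ι n))) (hqw : ((q : ℕ) : 𝓞 (ringClassField K ι n)) ∈ w.asIdeal) :
    ¬ (w.under (𝓞 ℚ)).asIdeal.map (algebraMap (𝓞 ℚ) (𝓞 (ringClassField K ι n))) ≤ w.asIdeal ^ 2 := by
  classical
  have hq : q.Prime := Fact.out
  -- the place `v = w ∩ 𝓞_K` of `K` below `w`
  let v : HeightOneSpectrum (𝓞 K) := w.under (𝓞 K)
  haveI : w.asIdeal.LiesOver v.asIdeal := ⟨rfl⟩
  have hqv : ((q : ℕ) : 𝓞 K) ∈ v.asIdeal := by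
    change ((q : ℕ) : 𝓞 K) ∈ w.asIdeal.comap (algebraMap (𝓞 K) (𝓞 (ringClassField K ι n)))
    rw [Ideal.mem_comap, map_natCast]
    exact hqw
  -- `v ∤ n`
  have hvn : ¬ Ideal.span {((n : ℕ) : 𝓞 K)} ≤ v.asIdeal := by
    intro hle
    have hnv : ((n : ℕ) : 𝓞 K) ∈ v.asIdeal := hle (Ideal.mem_span_singleton_self _)
    have hcop : IsCoprime ((q : ℤ) : 𝓞 K) ((n : ℤ) : 𝓞 K) :=
      (Nat.isCoprime_iff_coprime.mpr ((Nat.Prime.coprime_iff_not_dvd hq).mpr hqn)).map (Int.castRingHom (𝓞 K))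
    rw [Int.cast_natCast, Int.cast_natCast] at hcop
    obtain ⟨a, b, hab⟩ := hcop
    exact v.isPrime.ne_top ((Ideal.eq_top_iff_one _).mpr (hab ▸ v.asIdeal.add_mem (v.asIdeal.mul_mem_left a hqv)
      (v.asIdeal.mul_mem_left b hnv)))
  -- `e(w | v) = 1` (ring class fields are unramified outside the conductor)
  haveI : w.asIdeal.IsPrime := w.isPrime
  have hewv : w.asIdeal.ramificationIdx (𝓞 K) = 1 := ramificationIdx_ringClassField_eq_one hK ι hn hvn w.asIdeal
  -- `e(v | q) = 1` (`q` splits in `K`)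
  haveI : Algebra.IsQuadraticExtension ℚ K := ⟨hK.1⟩
  have hcard : Nat.card (K ≃ₐ[ℚ] K) = 2 := by rw [IsGalois.card_aut_eq_finrank, hK.1]
  obtain ⟨τ, hτ, huniq⟩ := (Nat.card_eq_two_iff' (1 : K ≃ₐ[ℚ] K)).mp hcard
  have hτ2 : τ * τ = 1 := by
    rw [mul_eq_one_iff_eq_inv]
    exact (huniq τ⁻¹ (inv_ne_one.mpr hτ)).symm
  obtain ⟨v₀, hv₀, -, hqv₀⟩ := ShimuraWalk.exists_split_place_of_ncard_eq_two K hK τ hτ q hq2 (dvd_refl q)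
  obtain ⟨σ, hσ⟩ := HeightOneSpectrum.exists_algEquiv_smul_eq (F := ℚ) (w := v₀) (w' := v)
    (LocalField.heightOneSpectrum_rat_eq_of_natCast_mem q _ _
      (LocalField.natCast_mem_under q v₀ hqv₀) (LocalField.natCast_mem_under q v hqv))
  have hτv : τ • v ≠ v := by
    by_cases hσ1 : σ = 1
    · subst hσ1
      rw [one_smul] at hσ
      rw [← hσ]
      exact hv₀
    · have hστ : σ = τ := huniq σ hσ1
      subst hστ
      rw [← hσ, smul_smul, hτ2, one_smul]
      exact fun h ↦ hv₀ h.symm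
  have hqτv : ((q : ℕ) : 𝓞 K) ∈ (τ • v).asIdeal := by
    have := (HeightOneSpectrum.smul_mem_smul_asIdeal_iff τ v ((q : ℕ) : 𝓞 K)).mpr hqv
    have hτq : τ • ((q : ℕ) : 𝓞 K) = (q : 𝓞 K) := by
      rw [← MulSemiringAction.toRingHom_apply, map_natCast]
    rwa [hτq] at this
  obtain ⟨⟨hev, -⟩, -⟩ := LocalField.ramificationIdx_eq_one_and_inertiaDeg_eq_one_of_ne q v (τ • v) hτv.symm hqv hqτv
  -- in `ramificationIdx'` currency, tower formula
  haveI : v.asIdeal.LiesOver (v.under (𝓞 ℚ)).asIdeal := ⟨rfl⟩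
  haveI : w.asIdeal.LiesOver (w.under (𝓞 ℚ)).asIdeal := ⟨rfl⟩
  have hunder : w.under (𝓞 ℚ) = v.under (𝓞 ℚ) := HeightOneSpectrum.ext (Ideal.under_under w.asIdeal).symm
  haveI : v.asIdeal.LiesOver (w.under (𝓞 ℚ)).asIdeal := by rw [hunder]; exact ⟨rfl⟩
  have h1 : (w.under (𝓞 ℚ)).asIdeal.ramificationIdx' v.asIdeal = 1 := by
    rw [Ideal.ramificationIdx'_eq_ramificationIdx _ _ (w.under (𝓞 ℚ)).ne_bot, ← hev]
  have h2 : v.asIdeal.ramificationIdx' w.asIdeal = 1 := by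
    rw [Ideal.ramificationIdx'_eq_ramificationIdx _ _ v.ne_bot, hewv]
  have h3 : (w.under (𝓞 ℚ)).asIdeal.ramificationIdx' w.asIdeal = 1 := by
    rw [Ideal.ramificationIdx'_algebra_tower' (w.under (𝓞 ℚ)).asIdeal v.asIdeal w.asIdeal, h1, h2]
  have hle : (w.under (𝓞 ℚ)).asIdeal.map (algebraMap (𝓞 ℚ) (𝓞 (ringClassField K ι n))) ≤ w.asIdeal :=
    Ideal.map_le_iff_le_comap.mpr le_rfl
  exact (not_iff_not.mpr (Ideal.ramificationIdx'_ne_one_iff hle)).mp (not_not.mpr h3)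

/-- (T) of `…CarrierLocalE0Global` for an ARBITRARY `DecidableEq L` instance on the coordinates (the landed statement carries the
classical one; `DecidableEq L` is a subsingleton). [cite: SilvermanAEC2009, Thm. VII.6.1] -/
theorem hasNonsingularReduction_pointGalHom_sub' (W : WeierstrassCurve ℚ) [W.IsElliptic] [W.IsGloballyMinimal]
    {L : Type} [Field L] [NumberField L] [DecidableEq L] (w : HeightOneSpectrum (𝓞 L)) (q : ℕ) [Fact q.Prime]
    (hqw : ((q : ℕ) : 𝓞 L) ∈ w.asIdeal)
    (he : ¬ (w.under (𝓞 ℚ)).asIdeal.map (algebraMap (𝓞 ℚ) (𝓞 L)) ≤ w.asIdeal ^ 2)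
    (h3 : 3 ∣ (W.baseChange ℚ_[q]).localTamagawaNumber ℤ_[q])
    (τ : L ≃ₐ[ℚ] L) (hτ : τ • w = w) (P : (W.baseChange L).toAffine.Point) :
    (placeIntModel W L w).HasNonsingularReduction (K := L) (pointGalHom W L τ P - P) := by
  obtain rfl : ‹DecidableEq L› = fun a b ↦ Classical.propDecidable (a = b) := Subsingleton.elim _ _
  exact hasNonsingularReduction_pointGalHom_sub W w q hqw he h3 τ hτ P

/-- (C) of `…CarrierLocalE0Global` for an ARBITRARY `DecidableEq L` instance on the coordinates. [cite: SilvermanAEC2009, Thm. VII.6.1] -/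
theorem hasNonsingularReduction_localTamagawaNumber_nsmul' (W : WeierstrassCurve ℚ) [W.IsElliptic] [W.IsGloballyMinimal]
    {L : Type} [Field L] [NumberField L] [DecidableEq L] (w : HeightOneSpectrum (𝓞 L)) (q : ℕ) [Fact q.Prime]
    (hqw : ((q : ℕ) : 𝓞 L) ∈ w.asIdeal)
    (he : ¬ (w.under (𝓞 ℚ)).asIdeal.map (algebraMap (𝓞 ℚ) (𝓞 L)) ≤ w.asIdeal ^ 2)
    (h3 : 3 ∣ (W.baseChange ℚ_[q]).localTamagawaNumber ℤ_[q]) (P : (W.baseChange L).toAffine.Point) :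
    (placeIntModel W L w).HasNonsingularReduction (K := L) ((W.baseChange ℚ_[q]).localTamagawaNumber ℤ_[q] • P) := by
  obtain rfl : ‹DecidableEq L› = fun a b ↦ Classical.propDecidable (a = b) := Subsingleton.elim _ _
  exact hasNonsingularReduction_localTamagawaNumber_nsmul W w q hqw he h3 P

/-- **`stub_carrierLocalE0AtThree` of `Lines/inert.lean` r17 (registered signature VERBATIM).** At a carrier prime `q` (`3 ∣ c_q(E/ℚ_q)`)
split in the imaginary quadratic `K`, for every level `n ≠ 0` with `q ∤ n` and every place `w ∋ q` of `K[n]`: (T) every `τ ∈ Aut_ℚ(K[n])`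
with `τ • w = w` acts trivially on `E(K[n]) ∕ E₀(K[n])_w`, and (C) `c_q • P ∈ E₀(K[n])_w`. Kodaira–Néron over the unramified completion
`K[n]_w ∕ ℚ_q` (the companion files), and the unramifiedness of `K[n]` at `w` (`not_map_le_sq_ringClassField`).
[cite: SilvermanATAEC1994, IV Cor. 9.2 (d), IV.9.4 Table 4.1] [cite: SilvermanAEC2009, Thm. VII.6.1, Prop. VII.5.4 (a)] [cite: Cox2013, §9.A] -/
theorem stub_carrierLocalE0AtThree :
    ∀ (W : WeierstrassCurve ℚ) [W.IsElliptic] [W.IsGloballyMinimal] (K : Type) [Field K] [NumberField K] (ι : K →+* ℂ)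
      [∀ j : ℕ, NumberField (ringClassField K ι j)],
      IsImaginaryQuadratic K → ∀ (q : ℕ) [Fact q.Prime], 3 ∣ (W.baseChange ℚ_[q]).localTamagawaNumber ℤ_[q] →
      ((Ideal.span {(q : ℤ)}).primesOver (𝓞 K)).ncard = 2 →
      (∀ n : ℕ, n ≠ 0 → ¬ q ∣ n → ∀ (w : HeightOneSpectrum (𝓞 (ringClassField K ι n))),
        ((q : ℕ) : 𝓞 (ringClassField K ι n)) ∈ w.asIdeal →
        ∀ τ : ringClassField K ι n ≃ₐ[ℚ] ringClassField K ι n, τ • w.asIdeal = w.asIdeal →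
        ∀ P : (W.baseChange (ringClassField K ι n)).toAffine.Point,
          (placeIntModel W (ringClassField K ι n) w).HasNonsingularReduction (K := ringClassField K ι n)
            (pointGalHom W (ringClassField K ι n) τ P - P)) ∧
      (∀ n : ℕ, n ≠ 0 → ¬ q ∣ n → ∀ (w : HeightOneSpectrum (𝓞 (ringClassField K ι n))),
        ((q : ℕ) : 𝓞 (ringClassField K ι n)) ∈ w.asIdeal →
        ∀ P : (W.baseChange (ringClassField K ι n)).toAffine.Point,
          (placeIntModel W (ringClassField K ι n) w).HasNonsingularReduction (K := ringClassField K ι n)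
            ((W.baseChange ℚ_[q]).localTamagawaNumber ℤ_[q] • P)) := by
  intro W _ _ K _ _ ι _ hK q _ h3 hq2
  refine ⟨fun n hn hqn w hqw τ hτ P ↦ ?_, fun n hn hqn w hqw P ↦ ?_⟩
  · have he := not_map_le_sq_ringClassField K ι hK q hq2 n hn hqn w hqw
    have hτ' : τ • w = w := HeightOneSpectrum.ext hτ
    exact hasNonsingularReduction_pointGalHom_sub' W w q hqw he h3 τ hτ' P
  · exact hasNonsingularReduction_localTamagawaNumber_nsmul' W w q hqw
      (not_map_le_sq_ringClassField K ι hK q hq2 n hn hqn w hqw) h3 P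

end Summit.BirchSwinnertonDyer.BirchSwinnertonDyer.Theorems.CarrierLocalE0

end
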